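/-
Copyright (c) 2026. All rights reserved.
Released under Apache 2.0 license as described in the file LICENSE.
-/
import Literature.NumberTheory.Automorphic.MaximalOrderDiscFiveLattice
import HarnessLib

/-!
# The maximal order `O₅` of `(−2,−5 ∣ ℚ)` is norm-Euclidean: every `ξ ∈ (−2,−5 ∣ ℚ)` lies within reduced norm `≤ 74/75 < 1`
# of `O₅`

[tag: quaternion_algebra] [tag: maximal_order] [tag: euclidean_algorithm]

Topic `NumberTheory/Automorphic`; THEOREMS ONLY (no definition, no named fact, no instance; net Literature debt `0`).
Lane `lit-hodgefound`, seat p12, gen 45 — sixth file on the definite quaternion order of discriminant `5`.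

Voight's Exercise 17.10 remarks that the maximal order of discriminant `5` «is in fact norm Euclidean» (Fitzgerald 2012), and
Vignéras observed that the maximal orders of discriminant `2, 3, 5` are exactly the norm-Euclidean ones. The coordinate-wise
("nearest plane") rounding that works for discriminants `2` and `3` CANNOT work for `O₅` (the Gram determinant `25/16` forces a
nearest-plane bound `≥ (25/16)^{1/4} > 1`); the proof below instead uses the structure of `(−2,−5 ∣ ℚ)` as the cyclic algebra
`(ℚ(η), −5)`: with `η = (−2+i+k)/4` (`η² + η + 1 = 0`) and `jη = η̄j`, every `ξ` is `u + vj` with `u, v ∈ ℚ(η) = ℚ ⊕ ℚη`,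
`nrd(u + vj) = N(u) + 5N(v)` (`N(e₁ + e₂η) = e₁² − e₁e₂ + e₂²`), and `O₅ ⊇ ℤ[η] ⊕ ℤ[η]j ⊕ ℤα` with `α = (1+i+j)/2 = (2+η)/3 + ((1−η)/3)j`.
ROUNDING: (1) round `π̄v` (`π̄ = 2 + η`, `N(π̄) = 3`) to `λ = λ₁ + λ₂η ∈ ℤ[η]` within `N ≤ 37/100` (`exists_round_eisenstein`: two
candidates in the hexagonal lattice); with `m = λ₁ + λ₂`, `s = λ₂` this puts `v` within `N ≤ 37/300` of `sη + m(1−η)/3`; (2) round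
`u − m(2+η)/3` to `p + qη ∈ ℤ[η]` within `N ≤ 37/100`; then `γ = p + qη + s·ηj + mα ∈ O₅` has
`nrd(ξ − γ) ≤ 37/100 + 5·37/300 = 74/75 < 1`.

* §1 **`exists_round_eisenstein`** (`∀ w ∈ ℚ², ∃ (p,q) ∈ ℤ²: N(w − (p + qη)) ≤ 37/100`);
* §2 **`exists_lattice_reducedNorm_sub_le`** (`≤ 74/75`), **`exists_lattice_reducedNorm_sub_lt_one`** — `O₅` IS NORM-EUCLIDEAN.

## Sources

* J. Voight, *Quaternion Algebras*, GTM 288 (2021), Exercise 17.10 («the maximal order for discriminant 5 is in fact norm Euclidean: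
  see Fitzgerald»), Lemma 11.3.2 / Prop. 11.3.4 (Euclidean ⟹ principal, Hurwitz order). [cite: Voight2021, Exercise 17.10; Lemma 11.3.2]
* M.-F. Vignéras, LNM 800 (1980), Ch. V §3 (the maximal orders of discriminant `2, 3, 5` are Euclidean for the norm). [cite: VignerasLNM800, Ch. V §3]
* R. W. Fitzgerald, *Norm Euclidean quaternionic orders*, Integers 12 (2012) 197–208 (the original proof; not consulted — the
  two-step rounding over `ℤ[η]` below is this file's own route to the printed statement).

## Scope (honest)

Theorems only. The constant `74/75` is what the two-candidate hexagonal rounding gives (the true Euclidean minimum is smaller);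
`# Cls O₅ = 1` is the sequel.
-/

open Quaternion

namespace Literature.NumberTheory.Automorphic.MaxOrderDiscFive

/-! ## §1 Rounding in the hexagonal lattice `ℤ[η]`, `N(e₁ + e₂η) = e₁² − e₁e₂ + e₂²` -/

section Eisenstein

/-- **Two-candidate rounding in `ℤ[η]`:** every `w₁ + w₂η ∈ ℚ(η)` is within `N ≤ 37/100` of some `p + qη ∈ ℤ[η]`
(`N(e₁ + e₂η) = (e₁ − e₂/2)² + ¾e₂²`; take `q ∈ {⌊w₂⌋, ⌊w₂⌋ + 1}` and `p` the nearest integer to `w₁ − (w₂ − q)/2`, choosing by cases on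
the fractional part of `w₂` and on the first rounding error). [cite: Voight2021, Lemma 11.3.2] -/
theorem exists_round_eisenstein (w₁ w₂ : ℚ) :
    ∃ p q : ℤ, (w₁ - p) ^ 2 - (w₁ - p) * (w₂ - q) + (w₂ - q) ^ 2 ≤ 37 / 100 := by
  obtain ⟨q₀, ε, hε0, hε1, hw₂⟩ : ∃ q₀ : ℤ, ∃ ε : ℚ, 0 ≤ ε ∧ ε < 1 ∧ w₂ = q₀ + ε :=
    ⟨⌊w₂⌋, Int.fract w₂, Int.fract_nonneg _, Int.fract_lt_one _, (Int.floor_add_fract w₂).symm⟩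
  obtain ⟨p₁, e, he, hw₁⟩ : ∃ p₁ : ℤ, ∃ e : ℚ, |e| ≤ 1 / 2 ∧ w₁ = p₁ + e + ε / 2 :=
    ⟨round (w₁ - ε / 2), w₁ - ε / 2 - round (w₁ - ε / 2), abs_sub_round _, by ring⟩
  obtain ⟨he1, he2⟩ := abs_le.1 he
  have hee : e ^ 2 ≤ 1 / 4 := by nlinarith
  by_cases h1 : ε ≤ 2 / 5
  · refine ⟨p₁, q₀, ?_⟩
    rw [hw₁, hw₂]
    nlinarith [mul_nonneg hε0 (sub_nonneg.2 h1)]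
  by_cases h2 : 3 / 5 ≤ ε
  · obtain ⟨p₂, e', he', hw₁'⟩ : ∃ p₂ : ℤ, ∃ e' : ℚ, |e'| ≤ 1 / 2 ∧ w₁ = p₂ + e' + (ε - 1) / 2 :=
      ⟨round (w₁ - (ε - 1) / 2), w₁ - (ε - 1) / 2 - round (w₁ - (ε - 1) / 2), abs_sub_round _, by ring⟩
    obtain ⟨he1', he2'⟩ := abs_le.1 he'
    have hee' : e' ^ 2 ≤ 1 / 4 := by nlinarith
    refine ⟨p₂, q₀ + 1, ?_⟩
    rw [hw₁', hw₂]
    push_cast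
    nlinarith [mul_nonneg (sub_nonneg.2 h2) (sub_nonneg.2 hε1.le)]
  rw [not_le] at h1 h2
  by_cases h3 : |e| ≤ 3 / 10
  · obtain ⟨he3, he4⟩ := abs_le.1 h3
    have hee3 : e ^ 2 ≤ 9 / 100 := by nlinarith
    refine ⟨p₁, q₀, ?_⟩
    rw [hw₁, hw₂]
    nlinarith [mul_nonneg (sub_nonneg.2 h1.le) (sub_nonneg.2 h2.le)]
  · rw [not_le] at h3
    by_cases h4 : 0 ≤ e
    · rw [abs_of_nonneg h4] at h3
      refine ⟨p₁ + 1, q₀ + 1, ?_⟩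
      rw [hw₁, hw₂]
      push_cast
      nlinarith [mul_nonneg (sub_nonneg.2 h1.le) (sub_nonneg.2 h2.le), mul_nonneg (sub_nonneg.2 h3.le) (sub_nonneg.2 he2)]
    · rw [not_le] at h4
      rw [abs_of_neg h4] at h3
      refine ⟨p₁, q₀ + 1, ?_⟩
      rw [hw₁, hw₂]
      push_cast
      nlinarith [mul_nonneg (sub_nonneg.2 h1.le) (sub_nonneg.2 h2.le), mul_nonneg (sub_nonneg.2 he1) (by linarith : (0 : ℚ) ≤ -3 / 10 - e)]

end Eisenstein

/-! ## §2 `O₅` is norm-Euclidean -/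

section Euclid

/-- **`O₅` IS NORM-EUCLIDEAN, with constant `74/75`:** for every `ξ = t + xi + yj + zk ∈ (−2,−5 ∣ ℚ)` there is `γ ∈ O₅` with
`nrd(ξ − γ) ≤ 74/75`. In the coordinates `ξ = u + vj`, `u = u₁ + u₂η`, `v = v₁ + v₂η` (`u₁ = t + (x + 5z)/3`, `u₂ = (2x + 10z)/3`,
`v₁ = y + (z − x)/3`, `v₂ = (2z − 2x)/3`, `nrd ξ = N(u) + 5N(v)`): round `π̄v = 2y + (y + z − x)η` to `λ₁ + λ₂η ∈ ℤ[η]`, put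
`m = λ₁ + λ₂`, `s = λ₂`, round `u − m(2+η)/3` to `p + qη`, and take `γ = p + qη + s·ηj + m·α = (p+s) − s·i + (m−s)α + (q+s)η ∈ O₅`;
then `nrd(ξ − γ) = N(u − p − qη − m(2+η)/3) + (5/3)·N(π̄v − λ) ≤ 37/100 + 37/60 = 74/75`. [cite: Voight2021, Exercise 17.10] [cite: VignerasLNM800, Ch. V §3] -/
theorem exists_lattice_reducedNorm_sub_le (ξ : ℍ[ℚ,-2,-5]) : ∃ lam ∈ (Submodule.span ℤ (Set.range ![(⟨1, 0, 0, 0⟩ : ℍ[ℚ,-2,-5]), ⟨0, 1, 0, 0⟩, ⟨1/2, 1/2, 1/2, 0⟩, ⟨-1/2, 1/4, 0, 1/4⟩])), reducedNorm ℚ ℍ[ℚ,-2,-5] (ξ - lam) ≤ 74 / 75 := by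
  obtain ⟨l₁, l₂, hv⟩ := exists_round_eisenstein (2 * ξ.imJ) (ξ.imJ + ξ.imK - ξ.imI)
  obtain ⟨p, q, hu⟩ := exists_round_eisenstein (ξ.re + (ξ.imI + 5 * ξ.imK) / 3 - 2 * ((l₁ : ℚ) + l₂) / 3)
    ((2 * ξ.imI + 10 * ξ.imK) / 3 - ((l₁ : ℚ) + l₂) / 3)
  refine ⟨_, mk_mem_lattice (p + l₂) (-l₂) (l₁ + l₂ - l₂) (q + l₂), ?_⟩
  rw [reducedNorm_eq]
  simp only [QuaternionAlgebra.re_sub, QuaternionAlgebra.imI_sub, QuaternionAlgebra.imJ_sub, QuaternionAlgebra.imK_sub]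
  push_cast
  nlinarith [hv, hu]

/-- **`O₅` IS NORM-EUCLIDEAN** (Voight Ex. 17.10 remark; Vignéras): for every `ξ ∈ (−2,−5 ∣ ℚ)` there is `γ ∈ O₅` with `nrd(ξ − γ) < 1`.
[cite: Voight2021, Exercise 17.10] [cite: VignerasLNM800, Ch. V §3] -/
theorem exists_lattice_reducedNorm_sub_lt_one (ξ : ℍ[ℚ,-2,-5]) : ∃ lam ∈ (Submodule.span ℤ (Set.range ![(⟨1, 0, 0, 0⟩ : ℍ[ℚ,-2,-5]), ⟨0, 1, 0, 0⟩, ⟨1/2, 1/2, 1/2, 0⟩, ⟨-1/2, 1/4, 0, 1/4⟩])), reducedNorm ℚ ℍ[ℚ,-2,-5] (ξ - lam) < 1 := by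
  obtain ⟨lam, hlam, h⟩ := exists_lattice_reducedNorm_sub_le ξ
  exact ⟨lam, hlam, h.trans_lt (by norm_num)⟩

end Euclid

end Literature.NumberTheory.Automorphic.MaxOrderDiscFive
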